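import Literature.NumberTheory.DiophantineGeometry.AbcWave0
import HarnessLib

/-!
# The quality form of abc (abc.S05) *is* the abc conjecture: the elementary reductions

`Literature.NumberTheory.DiophantineGeometry.ABCQualityForm` (abc.S05 in `Literature.NumberTheory.DiophantineGeometry.AbcWave0`:
"for every `ε > 0` only finitely many abc triples have quality
`q(a,b,c) = log c / log rad(abc) > 1 + ε`") is **not** a dischargeable named fact: it is the abc
conjecture of Masser–Oesterlé itself, in the dress "`1` is the largest accumulation point of the
abc-ratios" (Bombieri–Gubler, *Heights in Diophantine Geometry* (2006), Remark 12.4.15: "the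
abc-ratio is defined by `log max(|a|,|b|,|c|) / log rad(abc)` … the upper bound `1` is the strong
abc-conjecture"; Conjecture 12.2.2 is the `C(ε)` form; the abc-ratio is Masser's *quality*,
PAMS 130 (2002)). This companion file proves, sorry-free and without touching any statement of
`AbcWave0`, the elementary equivalences that pin this down inside `Literature/` (which cannot
import the summit `ABC` of `Summits/ABC/ABC/Statement.lean`):

* `IsABCTriple.one_add_lt_quality_iff` — for an abc triple, `1 + ε < q(a,b,c) ↔ rad(abc)^(1+ε) < c`
  (an abc triple has `rad(abc) ≥ 2`, so `log rad(abc) > 0` and the junk value of `quality` never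
  occurs);
* `abcQualityForm_iff_forall_exists_const` —
  `ABCQualityForm ↔ ∀ ε > 0, ∃ C > 0, ∀ abc triples, c < C · rad(abc)^(1+ε)`;
  the right-hand side is, word for word, the displayed sentence of the summit statement
  `ABC := Literature.Abc.ABCConjecture` (Bombieri–Gubler Conj. 12.2.2 in its strict-inequality /
  `C > 0` form), so the ABC route item "`ABCQualityForm ↔ ABCConjecture`" (route
  `ABC/InterimWave0`) is this theorem up to `Iff.rfl`, and a proof of `ABCQualityForm` would be a
  proof of the abc conjecture (open; the IUT claim is disputed, see
  `Literature.Barriers.ABC.IUTDisputedClaim`). The fact therefore stays an explicit hypothesis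
  `(h : ABCQualityForm)` for its users;
* `not_abcNegation_iff_forall_exists_const`, `abcQualityForm_iff_not_abcNegation` —
  `ABCQualityForm ↔ ¬ ABCNegation` (the abc.S02 negation flag of `AbcWave0`);
* `abcNegation_iff_infinite_quality_gt_holds` — **discharge** of the abc.S02 named fact
  `Literature.NumberTheory.DiophantineGeometry.abcNegation_iff_infinite_quality_gt` ("`ABCNegation` iff for some `ε > 0` there are
  infinitely many abc triples of quality `> 1 + ε`"), an immediate corollary.

## Proofs (Bombieri–Gubler, Remark 12.4.15, made explicit)

(⇐) Given `ε > 0`, use the constant `C = C(ε/2)`: a triple of quality `> 1 + ε` has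
`rad^(1+ε) < c < C · rad^(1+ε/2)`, whence `rad^(ε/2) < C`, `rad < C^(2/ε)`, so `rad ≤ R := ⌈C^(2/ε)⌉₊`
and `c < C · R^(1+ε/2)`, `c ≤ N := ⌈C · R^(1+ε/2)⌉₊`; the exceptional triples lie in the finite box
`[0, N]³`. (No appeal to the finiteness of triples with bounded radical, abc.S25, is needed.)
(⇒) Given `ε > 0`, the finitely many triples of quality `> 1 + ε` have `c ≤ N` for some `N`; every
other triple has `c ≤ rad^(1+ε)`; hence `c < (N + 2) · rad^(1+ε)` for every abc triple.
The passage between `¬ ABCNegation` (`∃ C`, no sign condition) and the `∃ C > 0` form replaces `C` by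
`max C 1`.

## References

* E. Bombieri, W. Gubler, *Heights in Diophantine Geometry*, New Math. Monogr. 4, CUP 2006:
  Conjecture 12.2.2 (strong abc), Remark 12.4.15 (abc-ratio; "the upper bound 1 is the strong
  abc-conjecture"), Example 12.4.14 (Reyssat's triple).
* D. W. Masser, *On abc and discriminants*, Proc. AMS 130 (2002) (quality of abc triples).
* J. Oesterlé, *Nouvelles approches du «théorème» de Fermat*, Sém. Bourbaki 694 (1988), §1.
-/

noncomputable section

open UniqueFactorizationMonoid

namespace Literature.NumberTheory.DiophantineGeometry

variable {a b c : ℕ}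

/-- An abc triple has `c ≥ 2` (`a, b ≥ 1` and `a + b = c`). [folklore] -/
theorem IsABCTriple.two_le (h : IsABCTriple a b c) : 2 ≤ c := by
  obtain ⟨ha, hb, habc, -⟩ := h
  omega

/-- An abc triple has `rad(abc) ≥ 2`: `abc ≥ 2` has a prime factor, so the radical computed in `ℕ`
is `> 1` (this is why the quality `log c / log rad(abc)` never takes its junk value on abc
triples; Oesterlé 1988, §1). [folklore] -/
theorem IsABCTriple.two_le_rad (h : IsABCTriple a b c) : 2 ≤ rad a b c := by
  obtain ⟨ha, hb, habc, -⟩ := h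
  have hab : 1 ≤ a * b := Nat.mul_pos ha hb
  have h1 : 1 < a * b * c :=
    calc 1 < c := by omega
      _ = 1 * c := (one_mul c).symm
      _ ≤ a * b * c := Nat.mul_le_mul_right c hab
  have h2 : 1 < rad a b c := by
    rw [rad_def, Nat.one_lt_radical_iff]
    exact h1
  omega

/-- For an abc triple, *quality `> 1 + ε`* means `rad(abc)^(1+ε) < c` (`Real.rpow`; the abc-ratio
`log c / log rad(abc)` of Bombieri–Gubler, Remark 12.4.15, with `log rad(abc) > 0`).
[cite: BombieriGubler2006, Rem. 12.4.15] -/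
theorem IsABCTriple.one_add_lt_quality_iff (h : IsABCTriple a b c) (ε : ℝ) :
    1 + ε < quality a b c ↔ ((rad a b c : ℕ) : ℝ) ^ (1 + ε) < c := by
  have hr : (1 : ℝ) < (rad a b c : ℝ) := by exact_mod_cast h.two_le_rad
  have hr0 : (0 : ℝ) < (rad a b c : ℝ) := zero_lt_one.trans hr
  have hc0 : (0 : ℝ) < (c : ℝ) := Nat.cast_pos.mpr (by have := h.two_le; omega)
  rw [quality, lt_div_iff₀ (Real.log_pos hr), ← Real.log_rpow hr0,
    Real.log_lt_log_iff (Real.rpow_pos_of_pos hr0 _) hc0]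

/-- For an abc triple, *quality `≤ 1 + ε`* means `c ≤ rad(abc)^(1+ε)`. [cite: BombieriGubler2006, Rem. 12.4.15] -/
theorem IsABCTriple.quality_le_iff (h : IsABCTriple a b c) (ε : ℝ) :
    quality a b c ≤ 1 + ε ↔ (c : ℝ) ≤ ((rad a b c : ℕ) : ℝ) ^ (1 + ε) := by
  rw [← not_lt, h.one_add_lt_quality_iff, not_lt]

/-- **(⇐)** The `C(ε)` form of abc (Bombieri–Gubler, Conj. 12.2.2, strict / `C > 0` version — the
sentence displayed in the summit statement `ABC`) implies the quality form `ABCQualityForm`: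
with `C = C(ε/2)`, a triple of quality `> 1 + ε` has `rad^(ε/2) < C`, hence bounded radical and
bounded `c`. [cite: BombieriGubler2006, Rem. 12.4.15] -/
theorem abcQualityForm_of_forall_exists_const
    (H : ∀ ε : ℝ, 0 < ε → ∃ C : ℝ, 0 < C ∧
      ∀ a b c : ℕ, IsABCTriple a b c → (c : ℝ) < C * ((rad a b c : ℕ) : ℝ) ^ (1 + ε)) :
    ABCQualityForm := by
  intro ε hε
  obtain ⟨C, hC, hCabc⟩ := H (ε / 2) (half_pos hε)
  have hεne : ε ≠ 0 := hε.ne'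
  -- `R` bounds the radical and `N` bounds `c` of every abc triple of quality `> 1 + ε`.
  set R : ℕ := ⌈C ^ (2 / ε)⌉₊ with hR
  set N : ℕ := ⌈C * (R : ℝ) ^ (1 + ε / 2)⌉₊ with hN
  refine ((Set.finite_Iic N).prod ((Set.finite_Iic N).prod (Set.finite_Iic N))).subset ?_
  rintro ⟨a, b, c⟩ hmem
  obtain ⟨ht, hq⟩ : IsABCTriple a b c ∧ 1 + ε < quality a b c := hmem
  have hlt : (c : ℝ) < C * (rad a b c : ℝ) ^ (1 + ε / 2) := hCabc a b c ht
  rw [ht.one_add_lt_quality_iff] at hq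
  have hr1 : (1 : ℝ) < (rad a b c : ℝ) := by exact_mod_cast ht.two_le_rad
  have hr0 : (0 : ℝ) < (rad a b c : ℝ) := zero_lt_one.trans hr1
  have hpos : (0 : ℝ) < (rad a b c : ℝ) ^ (1 + ε / 2) := Real.rpow_pos_of_pos hr0 _
  -- `rad^(ε/2) < C`
  have h1 : (rad a b c : ℝ) ^ (ε / 2) < C := by
    have hsplit : (rad a b c : ℝ) ^ (1 + ε) =
        (rad a b c : ℝ) ^ (1 + ε / 2) * (rad a b c : ℝ) ^ (ε / 2) := by
      rw [← Real.rpow_add hr0]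
      congr 1
      ring
    have h := hq.trans hlt
    rw [hsplit, mul_comm C] at h
    exact lt_of_mul_lt_mul_left h hpos.le
  -- `rad < C^(2/ε)`, hence `rad ≤ R`
  have h2 : (rad a b c : ℝ) ≤ R := by
    have h := Real.rpow_lt_rpow (Real.rpow_pos_of_pos hr0 _).le h1 (show (0 : ℝ) < 2 / ε by positivity)
    rw [← Real.rpow_mul hr0.le, show ε / 2 * (2 / ε) = 1 by field_simp, Real.rpow_one] at h
    exact h.le.trans (Nat.le_ceil _)
  -- `c < C · R^(1+ε/2)`, hence `c ≤ N`
  have h3 : (c : ℝ) ≤ N := by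
    have hRpow : (rad a b c : ℝ) ^ (1 + ε / 2) ≤ (R : ℝ) ^ (1 + ε / 2) :=
      Real.rpow_le_rpow hr0.le h2 (by positivity)
    have h : (c : ℝ) < C * (R : ℝ) ^ (1 + ε / 2) :=
      hlt.trans_le (mul_le_mul_of_nonneg_left hRpow hC.le)
    exact h.le.trans (Nat.le_ceil _)
  have hcN : c ≤ N := by exact_mod_cast h3
  obtain ⟨ha, hb, habc, -⟩ := ht
  simp only [Set.mem_prod, Set.mem_Iic]
  omega

/-- **(⇒)** The quality form `ABCQualityForm` implies the `C(ε)` form of abc (the sentence displayed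
in the summit statement `ABC`): the finitely many triples of quality `> 1 + ε` have `c ≤ N`, all
others have `c ≤ rad^(1+ε)`, so `C = N + 2` works. [cite: BombieriGubler2006, Rem. 12.4.15] -/
theorem forall_exists_const_of_abcQualityForm (H : ABCQualityForm) :
    ∀ ε : ℝ, 0 < ε → ∃ C : ℝ, 0 < C ∧
      ∀ a b c : ℕ, IsABCTriple a b c → (c : ℝ) < C * ((rad a b c : ℕ) : ℝ) ^ (1 + ε) := by
  intro ε hε
  have hfin := H ε hε
  -- `N` bounds `c` over the finitely many abc triples of quality `> 1 + ε`.
  obtain ⟨N, hN⟩ : ∃ N : ℕ, ∀ t ∈ {t : ℕ × ℕ × ℕ | IsABCTriple t.1 t.2.1 t.2.2 ∧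
      1 + ε < quality t.1 t.2.1 t.2.2}, t.2.2 ≤ N := by
    obtain ⟨N, hN⟩ := (hfin.image fun t => t.2.2).bddAbove
    exact ⟨N, fun t ht => hN (Set.mem_image_of_mem _ ht)⟩
  refine ⟨(N : ℝ) + 2, by positivity, fun a b c ht => ?_⟩
  have hN0 : (0 : ℝ) ≤ N := N.cast_nonneg
  have hr1 : (1 : ℝ) ≤ (rad a b c : ℝ) := by
    exact_mod_cast le_trans (by norm_num) ht.two_le_rad
  have hpow1 : (1 : ℝ) ≤ (rad a b c : ℝ) ^ (1 + ε) := Real.one_le_rpow hr1 (by positivity)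
  by_cases hq : 1 + ε < quality a b c
  · have hc : c ≤ N := hN (a, b, c) ⟨ht, hq⟩
    have hc' : (c : ℝ) ≤ N := by exact_mod_cast hc
    calc (c : ℝ) ≤ N := hc'
      _ < (N : ℝ) + 2 := by linarith
      _ = ((N : ℝ) + 2) * 1 := (mul_one _).symm
      _ ≤ ((N : ℝ) + 2) * (rad a b c : ℝ) ^ (1 + ε) :=
        mul_le_mul_of_nonneg_left hpow1 (by positivity)
  · rw [ht.one_add_lt_quality_iff, not_lt] at hq
    calc (c : ℝ) ≤ (rad a b c : ℝ) ^ (1 + ε) := hq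
      _ = 1 * (rad a b c : ℝ) ^ (1 + ε) := (one_mul _).symm
      _ < ((N : ℝ) + 2) * (rad a b c : ℝ) ^ (1 + ε) :=
        mul_lt_mul_of_pos_right (by linarith) (zero_lt_one.trans_le hpow1)

/-- **The quality form of abc is the abc conjecture** (Bombieri–Gubler, Remark 12.4.15: for the
abc-ratios `log c / log rad(abc)`, "the upper bound `1` [on their accumulation points] is the strong
abc-conjecture", Conj. 12.2.2). `ABCQualityForm ↔ ∀ ε > 0, ∃ C > 0, ∀ abc triples,
c < C · rad(abc)^(1+ε)`; the right-hand side is verbatim the sentence of the summit statement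
`ABC := Literature.Abc.ABCConjecture` (`Summits/ABC/ABC/Statement.lean`, not importable here), so
`ABCQualityForm` is an open problem, not a provable fact. [cite: BombieriGubler2006, Rem. 12.4.15] -/
theorem abcQualityForm_iff_forall_exists_const :
    ABCQualityForm ↔ ∀ ε : ℝ, 0 < ε → ∃ C : ℝ, 0 < C ∧
      ∀ a b c : ℕ, IsABCTriple a b c → (c : ℝ) < C * ((rad a b c : ℕ) : ℝ) ^ (1 + ε) :=
  ⟨forall_exists_const_of_abcQualityForm, abcQualityForm_of_forall_exists_const⟩

/-- Pushing the negation through the abc.S02 flag: `¬ ABCNegation` is the `C(ε)` form of abc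
(the unsigned constant `C` of `ABCNegation` is replaced by `max C 1 > 0`). [folklore] -/
theorem not_abcNegation_iff_forall_exists_const :
    ¬ ABCNegation ↔ ∀ ε : ℝ, 0 < ε → ∃ C : ℝ, 0 < C ∧
      ∀ a b c : ℕ, IsABCTriple a b c → (c : ℝ) < C * ((rad a b c : ℕ) : ℝ) ^ (1 + ε) := by
  unfold ABCNegation
  push Not
  refine forall_congr' fun ε => imp_congr_right fun _ => ⟨?_, ?_⟩
  · rintro ⟨C, hC⟩
    refine ⟨max C 1, lt_max_of_lt_right one_pos, fun a b c ht => (hC a b c ht).trans_le ?_⟩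
    exact mul_le_mul_of_nonneg_right (le_max_left C 1) (by positivity)
  · rintro ⟨C, -, hC⟩
    exact ⟨C, hC⟩

/-- `ABCQualityForm ↔ ¬ ABCNegation`: the quality form (abc.S05) is the negation of the abc-neg flag
(abc.S02), i.e. it is the abc conjecture. [cite: BombieriGubler2006, Rem. 12.4.15] -/
theorem abcQualityForm_iff_not_abcNegation : ABCQualityForm ↔ ¬ ABCNegation :=
  abcQualityForm_iff_forall_exists_const.trans not_abcNegation_iff_forall_exists_const.symm

/-- **Discharge of the abc.S02 named fact `Literature.NumberTheory.DiophantineGeometry.abcNegation_iff_infinite_quality_gt`**: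
`ABCNegation` holds iff for some `ε > 0` there are infinitely many abc triples of quality `> 1 + ε`
(elementary; the finiteness of abc triples with bounded radical, abc.S25, mentioned in the `AbcWave0`
docstring is not needed — the `C(ε/2)` bound and quality `> 1 + ε` already bound `rad(abc)` and `c`).
[cite: BombieriGubler2006, Rem. 12.4.15] [cite: Masser2002] -/
theorem abcNegation_iff_infinite_quality_gt_holds : abcNegation_iff_infinite_quality_gt := by
  unfold abcNegation_iff_infinite_quality_gt
  have h1 : ABCNegation ↔ ¬ ABCQualityForm := by
    rw [abcQualityForm_iff_not_abcNegation, not_not]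
  rw [h1]
  unfold ABCQualityForm
  push Not
  exact Iff.rfl

end Literature.NumberTheory.DiophantineGeometry

end
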